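import Literature.MathematicalPhysics.QuantumChemistry.SecondQuantizedHamiltonian
import HarnessLib

/-!
# Ventures/CertifiedQuantumChemistry — Statement (DRAFT v0.2 — operator adoption pending)

HONEST FRAMING (verbatim, page 1 of every file of the cell): certified bounds for a stated model
Hamiltonian in a stated basis; not a claim about the real molecule beyond that model.

STATUS. DRAFT written by the cell's typer (`pub-qchem-typer`, FANOUT T-03) as the typed companion of
`run/shared/lean/pub/pub-qchem/STATEMENT-DRAFT.md` (lead co-signs SD-1, SD-2); venture statements are
operator-owned (OP-01, 2026-08-20T22:24Z: "the venture Statement stays DRAFT — operator adoption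
pending; the typer drafts STATEMENT-DRAFT.md and may propose Statement.lean through the gate labelled
DRAFT"). Until adoption nothing here is a statement of record; the operator may rewrite any line.
NOTHING IS ASSERTED in this file: it defines the MODEL object, the certified QUANTITY and the ROW
PREDICATES with explicit rational slots. A row is instantiated only by a file under `Certificates/`
that derives it from a certificate predicate (`Rows/SectorRows.lean`) — whose hypothesis is an OPEN
CLAIM NODE carrying the sha256 of the integral file and of the certificate file(s), the reader verdicts
and the referee signature — or, for literal-sized models, by a kernel proof.

NOVELTY SENTENCE OF THE CELL (FRESHNESS §2 item 1, v1.3, verbatim intent): rigorous PQG / PQGT1 /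
PQGT1T2-grade SDP lower bounds are PRIOR ART for 55 instances up to r = 14 spatial orbitals
(Chaykin–Jansson–Keil et al. 2016/2020, VSDP/INTLAB on the ESC + Nakata SDPA files — incl. the cell's
S0a molecule N₂/STO-6G and the S0-A4 H₂O double-ζ) and are reproduced / compared, not claimed; at
r ≤ 14 the cell's new elements are (i) TWO-SIDEDNESS on one pinned model file with an exact upper
certificate, (ii) open two-verifier certificates whose identity is typed (and, where literal-sized,
replayable) in Lean, (iii) T2′ where certified; certified lower bounds of any grade at 14 < r ≤ 20 and
certified DQG brackets at r = 20–54 have no counterpart in print.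

## The object (rulings K1, K2, K3 of SCOPING.md §1)
* MODEL (K2): an integral file `F` (FCIDUMP, Knowles–Handy 1989) read EXACTLY — every decimal literal
  is the rational it prints — is the data `Model k = (h : Fin k → Fin k → ℚ, eri : Fin k⁴ → ℚ,
  ecore : ℚ)` of an active-space model with `k` spatial orbitals, AFTER the permutational completion
  fixed by the MODEL PIN (`FORMAT-pin1.md`: `model_sha256` identifies exactly this triple). Its
  Hamiltonian `Model.hamiltonian F` is the tree's second-quantized electronic Hamiltonian
  `molecularHamiltonian` (Literature, Helgaker–Jørgensen–Olsen (2.2.18)) with these rational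
  coefficients: `E_core·1 + Σ_{pq,σ} h_pq a†_{pσ}a_{qσ} + ½ Σ_{pqrs,στ} (pq|rs) a†_{pσ}a†_{rτ}a_{sτ}a_{qσ}`
  on the Fock space of the `2k` spin orbitals `Orb (Fin k)` (Jordan–Wigner index `2p + σ`, the
  convention line of FORMAT-qcl1 §2 / FORMAT-qcu0 §1). Literal tables in Lean only for `k ≤ 10`-class
  models and the Hubbard test vectors TV-H (K3: no `> 2·10⁴`-literal files); larger models appear in
  Lean only through claim nodes quoting `model_sha256`.
* QUANTITY (K1): `Model.energy F a b = sectorGroundEnergy F.hamiltonian a b`, the lowest eigenvalue of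
  `H_F` on the joint sector `N̂ = a + b`, `Ŝ_z = (a − b)/2` (`N_α = a`, `N_β = b`), i.e.
  `minEnergyOn H_F (szSector (a+b) ((a−b)/2))` — the SAME real number bounds from both sides. OFF THE
  PHYSICAL RANGE (`a > k` or `b > k`) the sector is trivial and `Model.energy` is the JUNK VALUE
  `sInf ∅ = 0`; NO ROW IS STATABLE THERE: the range `a ≤ k ∧ b ≤ k` is part of every row predicate
  (reviewer's fix on p241613; lead ruling SD-2).
* ROWS: `LowerRow F a b lo : a ≤ k ∧ b ≤ k ∧ (lo : ℝ) ≤ E₀(H_F; a, b)` (an SDP / v2RDM certificate: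
  D, Q, G, T1, T2, T2′ positivity = Gram positivity of `⟨O_I† O_J⟩`, exact dual, rational rounding,
  FORMAT-qcl1) and `UpperRow F a b hi : a ≤ k ∧ b ≤ k ∧ E₀(H_F; a, b) ≤ (hi : ℝ)` (exact Rayleigh data
  of an explicit sector-pure trial state, FORMAT-qcu0); `Bracket` = both. Width / comparator
  predicates are decidable statements about the rational SLOTS only (never claims about `E₀`):
  `Width lo hi tol` (generic — no per-rung tolerance constants, SD-1 (b); W is printed per row next to
  the 1.6 mE_h yardstick), `RefInside lo hi ref` / `RefIntervalMeets lo hi ref err` (a printed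
  reference value, e.g. an exact FCI energy or a published SDPA-GMP optimum, lies in / meets the
  bracket — a falsification test, not an input).

## Ladder (SCOPING.md §1, v1.3 abridged; widths are EXPECTATIONS from printed float tables, not promises)
R0/S0-H: 1D Hubbard rings L = 4 (2,2) / L = 6 (3,3), U/t ∈ {1, 10, 10², 10³, 10⁴}, TV-H files
(two-sided; parity vs Nakata 2008 SDPA-GMP optima) · R0/S0a: N₂ STO-6G (14e,10o) (7,7), R_e = 1.0977 Å
and stretched R: PQG…PQGT1T2′ lower + exact-FCI-vector upper; compare Chaykin et al. 2020 rigorous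
E₂ = −108.70168 · S0b: N₂ cc-pVDZ (14e,28o), d ∈ {2.2, 4.0, 10.0} a₀ · S0-A4: H₂O double-ζ r = 14
(Chaykin Tab. 5) · S0c: H₁₀ STO-6G, R ∈ {1.0, 1.786, 2.4, 3.2} a₀ · R1: Cr₂ (24e,30o)/SV · R2a:
[2Fe-2S] (30e,20o) · R2b: [4Fe-4S] (54e,36o) · R3a: FeMoco (54e,54o) · R3b (gen-2): FeMoco (113e,76o).
Rows at `k ≥ 20` are certificate RECORDS (CERTIFIED.md), not Lean literals.

## Soundness (what makes a row true; `Rows/SectorRows.lean`, typer T-04)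
(L) `LowerCertificate F a b lo → F.IsSymmetric → a ≤ k → b ≤ k → LowerRow F a b lo`: an operator
identity `H_F − c·1 = Σ Λ_IJ O_I† O_J + (ideal of (N̂_↑ − a), (N̂_↓ − b); commutators; charged words)
+ (anti-Hermitian parts + Σ a_k v_k)` with `Λ ⪰ 0` and contraction words `v_k` gives
`lo = c − Σ‖a_k‖ ≤ E₀` — evaluation in the tracial ground state of the sector (tree:
`Matrix.re_projState_ge_of_local_certificate`, Han 2020 §2 / Kull–Schuch–Dive–Navascués 2024 §5.3;
for molecules = v2RDM weak duality, Mazziotti 2007 §II.B/E, Fukuda–Nakata–Yamashita 2007 §I, made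
rigorous à la Chaykin–Jansson–Keil et al. 2020). The cell's ideal form of record is the right ideal
generated by `N̂_σ − N_σ` (FORMAT-qcl1 §5); it is equivalent to the tree's `(N̂ − N, Ŝ_z − M)` form
since `N̂_σ − N_σ = ½ (N̂ − N) ± (Ŝ_z − M)` (SD-1 (d)).
(U) `UpperCertificate F a b hi → F.IsSymmetric → UpperRow F a b hi`: Rayleigh–Ritz in the sector
(tree: `sectorGroundEnergy_le_of_rayleigh`; the witness forces the range); conversely every true upper
row has such a certificate (the sector ground state), so the certificate predicate is exactly as strong
as the row.

Change log: 2026-08-20 typer g1 (literature-prover-pub-qchem-typer-0): v0 DRAFT (p241613, bounced by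
review 2026-08-21T00:15:51Z with one fix); v0.1 DRAFT: the range `a ≤ k ∧ b ≤ k` is part of
`LowerRow` / `UpperRow` (reviewer option A = lead ruling SD-2), QUANTITY docstring states the junk
value, novelty sentence (SD-1 (a)) and `RefIntervalMeets` added; nothing else changed.
-/

noncomputable section

namespace Summit.Ventures.CertifiedQuantumChemistry

open Matrix
open Literature.MathematicalPhysics.QuantumLattice Literature.MathematicalPhysics.QuantumChemistry

/-! ## The model object -/

/-- An exact-rational active-space MODEL with `k` spatial orbitals: one-electron integrals `h`,
two-electron integrals `eri p q r s = (pq|rs)` (chemists' notation) and the scalar `ecore`, all read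
as the exact rationals an integral file prints (ruling K2; `FORMAT-pin1.md` `qchem-modelpin/1` after
permutational completion). No symmetry is built in: `IsSymmetric` is a separate, decidable predicate. -/
structure Model (k : ℕ) where
  /-- one-electron integrals `h_pq` -/
  h : Fin k → Fin k → ℚ
  /-- two-electron integrals `(pq|rs)` in chemists' (Mulliken) notation -/
  eri : Fin k → Fin k → Fin k → Fin k → ℚ
  /-- the scalar constant (nuclear repulsion + frozen core), `0` if the file's `ecore_flag` says so -/
  ecore : ℚ

namespace Model

variable {k : ℕ}

/-- The model Hamiltonian `H_F = E_core·1 + Σ_{pq,σ} h_pq a†_{pσ}a_{qσ} + ½ Σ (pq|rs) a†_{pσ}a†_{rτ}a_{sτ}a_{qσ}`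
on the Fock space of `Orb (Fin k)`: the Literature `molecularHamiltonian` at the rational data. -/
def hamiltonian (F : Model k) : Matrix (Finset (Orb (Fin k))) (Finset (Orb (Fin k))) ℂ :=
  molecularHamiltonian (fun p q => (F.h p q : ℂ)) (fun p q r s => (F.eri p q r s : ℂ)) (F.ecore : ℂ)

/-- The integral symmetries that make `H_F` Hermitian: `h` symmetric and `(pq|rs) = (qp|sr)` (both
hold after the 8-fold real completion of the MODEL PIN; stated as the minimal rule actually used). -/
def IsSymmetric (F : Model k) : Prop :=
  (∀ p q, F.h p q = F.h q p) ∧ ∀ p q r s, F.eri p q r s = F.eri q p s r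

/-- `IsSymmetric` is decidable on the rational tables (closes by `decide` for literal models). -/
instance (F : Model k) : Decidable F.IsSymmetric :=
  inferInstanceAs (Decidable ((∀ p q, F.h p q = F.h q p) ∧ ∀ p q r s, F.eri p q r s = F.eri q p s r))

/-- A symmetric model has a Hermitian Hamiltonian (`molecularHamiltonian_isHermitian`). -/
theorem hamiltonian_isHermitian {F : Model k} (hF : F.IsSymmetric) : F.hamiltonian.IsHermitian :=
  molecularHamiltonian_isHermitian (fun p q => by rw [Complex.star_def, map_ratCast, hF.1 p q])
    (fun p q r s => by rw [Complex.star_def, map_ratCast, hF.2 p q r s])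
    (by rw [Complex.star_def, map_ratCast])

/-- The certified QUANTITY (ruling K1): the `(N_α, N_β) = (a, b)` sector ground-state energy of `H_F`.
JUNK VALUE `0` off the physical range `a ≤ k ∧ b ≤ k` (trivial sector, `sInf ∅`); rows carry the range. -/
def energy (F : Model k) (a b : ℕ) : ℝ := sectorGroundEnergy F.hamiltonian a b

end Model

/-! ## Row predicates (explicit rational slots; the physical range is part of the row; nothing asserted) -/

variable {k : ℕ}

/-- LOWER row: the sector `(a, b)` exists (`a ≤ k ∧ b ≤ k`) and the rational `lo` is a lower bound of
its ground energy, `(lo : ℝ) ≤ E₀(H_F; a, b)`. -/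
def LowerRow (F : Model k) (a b : ℕ) (lo : ℚ) : Prop := a ≤ k ∧ b ≤ k ∧ ((lo : ℚ) : ℝ) ≤ F.energy a b

/-- UPPER row: the sector `(a, b)` exists (`a ≤ k ∧ b ≤ k`) and `E₀(H_F; a, b) ≤ (hi : ℝ)`. -/
def UpperRow (F : Model k) (a b : ℕ) (hi : ℚ) : Prop := a ≤ k ∧ b ≤ k ∧ F.energy a b ≤ ((hi : ℚ) : ℝ)

/-- Two-sided row (certified bracket) = lower ∧ upper, each side with its own certificate; inherits the
range from either side. -/
def Bracket (F : Model k) (a b : ℕ) (lo hi : ℚ) : Prop := LowerRow F a b lo ∧ UpperRow F a b hi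

/-- The bracket is exactly the conjunction of the one-sided rows. -/
theorem bracket_iff (F : Model k) (a b : ℕ) (lo hi : ℚ) :
    Bracket F a b lo hi ↔ LowerRow F a b lo ∧ UpperRow F a b hi := Iff.rfl

/-- A row lives on the physical range. -/
theorem LowerRow.range {F : Model k} {a b : ℕ} {lo : ℚ} (h : LowerRow F a b lo) : a ≤ k ∧ b ≤ k :=
  ⟨h.1, h.2.1⟩

/-- A row lives on the physical range. -/
theorem UpperRow.range {F : Model k} {a b : ℕ} {hi : ℚ} (h : UpperRow F a b hi) : a ≤ k ∧ b ≤ k :=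
  ⟨h.1, h.2.1⟩

/-- The inequality carried by a lower row. -/
theorem LowerRow.le {F : Model k} {a b : ℕ} {lo : ℚ} (h : LowerRow F a b lo) :
    ((lo : ℚ) : ℝ) ≤ F.energy a b :=
  h.2.2

/-- The inequality carried by an upper row. -/
theorem UpperRow.le {F : Model k} {a b : ℕ} {hi : ℚ} (h : UpperRow F a b hi) :
    F.energy a b ≤ ((hi : ℚ) : ℝ) :=
  h.2.2

/-- A lower row may be weakened downwards. -/
theorem LowerRow.mono {F : Model k} {a b : ℕ} {lo lo' : ℚ} (h : LowerRow F a b lo) (hle : lo' ≤ lo) :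
    LowerRow F a b lo' :=
  ⟨h.1, h.2.1, le_trans (by exact_mod_cast hle) h.2.2⟩

/-- An upper row may be weakened upwards. -/
theorem UpperRow.mono {F : Model k} {a b : ℕ} {hi hi' : ℚ} (h : UpperRow F a b hi) (hle : hi ≤ hi') :
    UpperRow F a b hi' :=
  ⟨h.1, h.2.1, le_trans h.2.2 (by exact_mod_cast hle)⟩

/-- Consistency of a bracket: its slots are ordered (`lo ≤ hi`); a bracket with `hi < lo` would be an
EVENT (one of the two certificates, or the model identity, is wrong). -/
theorem Bracket.lo_le_hi {F : Model k} {a b : ℕ} {lo hi : ℚ} (h : Bracket F a b lo hi) : lo ≤ hi := by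
  have h' : ((lo : ℚ) : ℝ) ≤ ((hi : ℚ) : ℝ) := le_trans h.1.le h.2.le
  exact_mod_cast h'

/-! ## Decidable predicates on the slots (reporting thresholds and falsification tests)

These speak about the SLOTS `lo`, `hi` of a row only — never about `E₀` — and are closed by `decide` /
`norm_num` on literal rows. -/

/-- Width of a bracket at most `tol` (a threshold on the slots, e.g. `tol = 16/10000` E_h for
"chemical accuracy", `10⁻⁶·t` for the S0-H parity target; generic by ruling SD-1 (b): no per-rung
tolerance constants; never a claim about `E₀`). -/
def Width (lo hi tol : ℚ) : Prop := hi - lo ≤ tol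

/-- Decidability of this rational-slot predicate (by `inferInstanceAs`; lets `decide`/`norm_num` close instances). -/
instance (lo hi tol : ℚ) : Decidable (Width lo hi tol) := inferInstanceAs (Decidable (hi - lo ≤ tol))

/-- A bracket meeting a tolerance meets every weaker tolerance. -/
theorem Width.mono {lo hi tol tol' : ℚ} (h : Width lo hi tol) (hle : tol ≤ tol') : Width lo hi tol' :=
  le_trans h hle

/-- Falsification / parity test on the slots: a printed reference value `ref` (exact FCI energy,
published SDPA-GMP optimum, …, read as the rational it prints) lies inside the bracket `[lo, hi]`;
a certified bracket EXCLUDING a printed exact value is an EVENT (model identity or the print is wrong). -/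
def RefInside (lo hi ref : ℚ) : Prop := lo ≤ ref ∧ ref ≤ hi

/-- Decidability of this rational-slot predicate (by `inferInstanceAs`; lets `decide`/`norm_num` close instances). -/
instance (lo hi ref : ℚ) : Decidable (RefInside lo hi ref) :=
  inferInstanceAs (Decidable (lo ≤ ref ∧ ref ≤ hi))

/-- Printed reference with an error bar `[ref − err, ref + err]` MEETS the bracket (non-empty
intersection; the shape used for float comparators such as DMRG / SDP optima quoted to finite digits). -/
def RefIntervalMeets (lo hi ref err : ℚ) : Prop := lo ≤ ref + err ∧ ref - err ≤ hi

/-- Decidability of this rational-slot predicate (by `inferInstanceAs`; lets `decide`/`norm_num` close instances). -/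
instance (lo hi ref err : ℚ) : Decidable (RefIntervalMeets lo hi ref err) :=
  inferInstanceAs (Decidable (lo ≤ ref + err ∧ ref - err ≤ hi))

/-- A reference inside the bracket meets it with any non-negative error bar. -/
theorem RefInside.meets {lo hi ref : ℚ} (h : RefInside lo hi ref) {err : ℚ} (herr : 0 ≤ err) :
    RefIntervalMeets lo hi ref err :=
  ⟨le_trans h.1 (le_add_of_nonneg_right herr), le_trans (sub_le_self ref herr) h.2⟩

/-- Under a bracket, a reference value inside it is within the bracket width of `E₀`:
`|E₀ − ref| ≤ hi − lo` (the bracket carries the range, so `E₀` here is never the junk value). -/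
theorem abs_energy_sub_ref_le {F : Model k} {a b : ℕ} {lo hi ref : ℚ} (h : Bracket F a b lo hi)
    (href : RefInside lo hi ref) : |F.energy a b - ((ref : ℚ) : ℝ)| ≤ ((hi - lo : ℚ) : ℝ) := by
  have h1 := h.1.le
  have h2 := h.2.le
  obtain ⟨h3, h4⟩ := href
  have h3' : ((lo : ℚ) : ℝ) ≤ ((ref : ℚ) : ℝ) := by exact_mod_cast h3
  have h4' : ((ref : ℚ) : ℝ) ≤ ((hi : ℚ) : ℝ) := by exact_mod_cast h4
  push_cast
  rw [abs_le]
  constructor <;> linarith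

/-! ## Singlet-restricted rows (v0.2): the `⟨Ŝ²⟩ = 0` certificates

CERTIFIED.md rows keyed `e0S0[…]` (FORMAT-qcl1 with the spin EQUALITY row E3, `S = 0`: the state is
constrained by `ω(Ŝ_−Ŝ_+) = S(S+1) − M(M+1) = 0`) certify a DIFFERENT, larger quantity than
`Model.energy F n n`: the lowest energy of `H_F` among the SINGLET states of the `2n`-electron sector,
`E₀(H_F; N = 2n, S = 0)`. A vector of the `(n, n)` sector (`S_z = 0`) is a singlet iff it is
annihilated by the raising operator `Ŝ_+` (a weight-`0` highest-weight vector has total spin `0`;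
equivalently `Ŝ_−Ŝ_+ψ = 0`, equivalently `Ŝ²ψ = 0` since `Ŝ² = Ŝ_−Ŝ_+ + Ŝ_z(Ŝ_z + 1)`), which is the
definition used here. Since `Ŝ_−Ŝ_+ ⪰ 0`, a density matrix on the sector with `Tr ρ Ŝ_−Ŝ_+ = 0` is
supported on this subspace, so the E3-constrained SDP value bounds exactly this quantity from below
(soundness: `Rows/SingletRows.lean`). For the spin-free `H_F` (`[H_F, Ŝ_±] = 0`, HJO §2.3.4) the singlet
subspace is `H_F`-invariant and `Model.energy F n n ≤ Model.singletEnergy F n`, with equality iff the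
`2n`-electron ground multiplet contains a singlet (true for N₂ and H₁₀ at the geometries filed, but NOT
a theorem of the model in general — hence separate row predicates, never a silent identification). -/

/-- The SINGLET subspace of the `2n`-electron sector of a `k`-orbital model: the `(n, n)` determinant
sector (`N̂ = 2n`, `Ŝ_z = 0`, written with the same arguments as `Model.energy F n n`) intersected with
`ker Ŝ_+`. -/
def singletSector (k n : ℕ) : Submodule ℂ (Fock (Orb (Fin k))) :=
  szSector (n + n) (((n : ℝ) - n) / 2) ⊓
    LinearMap.ker (Matrix.toLin' (spinPlus : Matrix (Finset (Orb (Fin k))) (Finset (Orb (Fin k))) ℂ))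

/-- Membership in the singlet subspace: in the `(n, n)` sector and annihilated by `Ŝ_+`. -/
theorem mem_singletSector_iff {k n : ℕ} (ψ : Fock (Orb (Fin k))) :
    ψ ∈ singletSector k n ↔ ψ ∈ szSector (n + n) (((n : ℝ) - n) / 2) ∧ spinPlus *ᵥ ψ = 0 := by
  rw [singletSector, Submodule.mem_inf, LinearMap.mem_ker, Matrix.toLin'_apply]

/-- THE SINGLET QUANTITY. `Model.singletEnergy F n = E₀(H_F; N = 2n, S = 0)`: the lowest energy of the
model Hamiltonian on the singlet subspace of the `2n`-electron sector. Physical range `n ≤ k`; beyond it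
the subspace is `⊥` and the value is the junk `sInf ∅ = 0` (no row is stated there: the range is part
of the row predicates). -/
def Model.singletEnergy (F : Model k) (n : ℕ) : ℝ :=
  F.hamiltonian.minEnergyOn (singletSector k n)

/-- CERTIFIED SINGLET LOWER ROW: `n ≤ k` and `lo ≤ E₀(H_F; N = 2n, S = 0)`. -/
def SingletLowerRow (F : Model k) (n : ℕ) (lo : ℚ) : Prop :=
  n ≤ k ∧ ((lo : ℚ) : ℝ) ≤ F.singletEnergy n

/-- CERTIFIED SINGLET UPPER ROW: `n ≤ k` and `E₀(H_F; N = 2n, S = 0) ≤ hi`. -/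
def SingletUpperRow (F : Model k) (n : ℕ) (hi : ℚ) : Prop :=
  n ≤ k ∧ F.singletEnergy n ≤ ((hi : ℚ) : ℝ)

/-- A two-sided singlet row. -/
def SingletBracket (F : Model k) (n : ℕ) (lo hi : ℚ) : Prop :=
  SingletLowerRow F n lo ∧ SingletUpperRow F n hi

/-- A singlet lower row carries its range `n ≤ k`. -/
theorem SingletLowerRow.range {F : Model k} {n : ℕ} {lo : ℚ} (h : SingletLowerRow F n lo) : n ≤ k :=
  h.1

/-- A singlet upper row carries its range `n ≤ k`. -/
theorem SingletUpperRow.range {F : Model k} {n : ℕ} {hi : ℚ} (h : SingletUpperRow F n hi) : n ≤ k :=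
  h.1

/-- The inequality of a singlet lower row. -/
theorem SingletLowerRow.le {F : Model k} {n : ℕ} {lo : ℚ} (h : SingletLowerRow F n lo) :
    ((lo : ℚ) : ℝ) ≤ F.singletEnergy n :=
  h.2

/-- The inequality of a singlet upper row. -/
theorem SingletUpperRow.le {F : Model k} {n : ℕ} {hi : ℚ} (h : SingletUpperRow F n hi) :
    F.singletEnergy n ≤ ((hi : ℚ) : ℝ) :=
  h.2

/-- Weakening a singlet lower row. -/
theorem SingletLowerRow.mono {F : Model k} {n : ℕ} {lo lo' : ℚ} (h : SingletLowerRow F n lo)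
    (hle : lo' ≤ lo) : SingletLowerRow F n lo' :=
  ⟨h.1, le_trans (by exact_mod_cast hle) h.2⟩

/-- Weakening a singlet upper row. -/
theorem SingletUpperRow.mono {F : Model k} {n : ℕ} {hi hi' : ℚ} (h : SingletUpperRow F n hi)
    (hle : hi ≤ hi') : SingletUpperRow F n hi' :=
  ⟨h.1, le_trans h.2 (by exact_mod_cast hle)⟩

/-- A singlet bracket is consistent: `lo ≤ hi`. -/
theorem SingletBracket.lo_le_hi {F : Model k} {n : ℕ} {lo hi : ℚ} (h : SingletBracket F n lo hi) :
    lo ≤ hi := by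
  have := le_trans h.1.2 h.2.2
  exact_mod_cast this

end Summit.Ventures.CertifiedQuantumChemistry

end
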